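import Literature.NumberTheory.LFunctions.ZeroCountingLevinsonProofs
import Literature.NumberTheory.LFunctions.LevinsonMontgomeryTheorem
import Literature.NumberTheory.LFunctions.ZetaZerosReflection
import Literature.NumberTheory.LFunctions.ZetaZerosOffLine
import HarnessLib

/-!
# Levinson's identity `N₀(T) = N(T) − 2N₁⁻(T) + O(log T)` and the critical-line proportion via the zeros of `ζ'`

Sibling of `Literature/NumberTheory/LFunctions/ZeroCounting.lean` (rh.S15: the named facts
`criticalLineProportion_pos`, `one_third_le_criticalLineProportion`, `conrey_bound`, `przz_bound`
about `κ = liminf N₀(T)/N(T) = Literature.NumberTheory.LFunctions.criticalLineProportion`).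
Proofs only: no definitions and no named facts are introduced.

The first step of Levinson's method (Levinson 1974, §1; Levinson–Montgomery 1974, Theorem 1;
Titchmarsh–Heath-Brown §10.28, (10.28.2) and (10.28.7)) converts a lower bound for the number
`N₀` of zeros of `ζ` on the critical line into an upper bound for the number of zeros of `ζ'` to
the left of it:

* the zeros of `ζ` off the critical line come in pairs `ρ`, `1 − ρ̄` with equal ordinates and equal
  multiplicities (functional equation and `ζ(s̄) = conj ζ(s)`; the tree's
  `riemannZetaZeroOrder_one_sub_conj`, `ZetaZerosReflection.lean`), so that **exactly**
  `N(T) − N₀(T) = 2 · #{ρ : ζ(ρ) = 0, Re ρ < 1/2, 0 < Im ρ ≤ T}` (with multiplicity) for every `T`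
  (`intCast_zetaZeroCount_sub_criticalZeroCount_eq_two_mul_finsum`; in particular `N(T) − N₀(T)` is
  even, and `2N⁻(T) ≤ N(T) − N₀(T) ≤ 2N⁻(T')` for `T < T'`, where
  `N⁻ = Literature.NumberTheory.LFunctions.zetaLeftCount` is Levinson–Montgomery's count over the
  open box `0 < σ < 1/2`, `0 < t < T` of `LevinsonMontgomery.lean`);
* Levinson–Montgomery's Theorem 1, `N₁⁻(T) = N⁻(T) + O(log T)` (`N₁⁻ = derivZetaLeftCount`, zeros
  of `ζ'` in the same box; **proved** in the tree, `levinsonMontgomery_thm1_isBigO_holds`,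
  `LevinsonMontgomeryTheorem.lean`), and `N(T) − N(T − 1) = O(log T)` (from the proved
  Riemann–von Mangoldt formula `riemann_von_mangoldt_holds`) then give **Titchmarsh's (10.28.7)**
  in the form `N₀(T) = N(T) − 2N₁⁻(T) + O(log T)` (`isBigO_criticalZeroCount_levinson`);
* consequently, for every real `α`: `α ≤ κ ↔ ∀ ε > 0, 2N₁⁻(T) ≤ (1 − α + ε) N(T)` for all large
  `T` (`le_criticalLineProportion_iff_derivZetaLeftCount`), and
  `α < κ ↔ ∃ c < 1 − α, 2N₁⁻(T) ≤ c N(T)` for all large `T`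
  (`lt_criticalLineProportion_iff_derivZetaLeftCount`); the `≤` form also with `N⁻` in place of
  `N₁⁻` (`le_criticalLineProportion_iff_zetaLeftCount`).
  In particular the named fact `przz_bound` (`κ > 5/12`, Pratt–Robles–Zaharescu–Zeindler 2020) is
  equivalent to: *for some `c < 7/12`, `2N₁⁻(T) ≤ c N(T)` for all large `T`*
  (`przz_bound_iff_derivZetaLeftCount`), i.e. fewer than `7/24` of the zeros of `ζ'` (counted
  against `N(T)`) lie in `0 < Re s < 1/2` — the form in which Levinson's method with a linear
  polynomial `Q` delivers its output (Titchmarsh (10.28.11): an upper bound for the zeros of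
  `ζ'(1 − s)` to the right of the line via Littlewood's lemma for the mollified
  `G = ζ + ζ'/F`, `G ψ`).

What is NOT here: any upper bound for `N₁⁻(T)` itself (Littlewood's lemma for `Gψ`, the mollified
mean square (10.28.10), and — for `κ > 5/12` — Conrey's general zero-detection inequality with
`V = Q(−L⁻¹ d/ds) ζ` of degree `> 1` (Conrey 1983, §4, (1)–(3)) together with the twisted second
moment of Pratt–Robles–Zaharescu–Zeindler, Thm. 4.1, and the numerics of their §8). Those remain
recorded in the named fact `przz_bound`.

## Contents (all proved)

* `one_sub_conj_mem_zetaZeroBox` — the reflection `ρ ↦ 1 − ρ̄` preserves `zetaZeroBox 0 T`;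
  `bijOn_one_sub_conj_leftZeros` — and maps the zeros with `Re ρ < 1/2` onto those with
  `1/2 < Re ρ`; `finsum_rightZeros_eq_finsum_leftZeros` — with the same multiplicity sums.
* `intCast_zetaZeroCount_sub_criticalZeroCount_eq_two_mul_finsum` — `N(T) − N₀(T) = 2 Σ_{Re ρ < 1/2} m(ρ)`;
  `even_zetaZeroCount_sub_criticalZeroCount`.
* `two_mul_zetaLeftCount_le`, `zetaZeroCount_sub_criticalZeroCount_le_two_mul_zetaLeftCount`,
  `zetaZeroCount_sub_criticalZeroCount_eq_two_mul_zetaLeftCount` (equality when `T` is not an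
  ordinate) — comparison with Levinson–Montgomery's `N⁻(T)`.
* `isBigO_zetaZeroCount_sub_zetaZeroCount_sub_one` — `N(T) − N(T − 1) = O(log T)` (Titchmarsh Thm. 9.2,
  here from Thm. 9.4); `isBigO_criticalZeroCount_levinson_zetaLeftCount` —
  `N₀(T) − (N(T) − 2N⁻(T)) = O(log T)`; `isBigO_criticalZeroCount_levinson` — **(10.28.7)**
  `N₀(T) − (N(T) − 2N₁⁻(T)) = O(log T)`.
* `le_criticalLineProportion_iff_of_isLittleO` (template), `le_criticalLineProportion_iff_zetaLeftCount`,
  `le_criticalLineProportion_iff_derivZetaLeftCount`, `lt_criticalLineProportion_iff_derivZetaLeftCount`,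
  `przz_bound_iff_derivZetaLeftCount`, `przz_bound_of_derivZetaLeftCount_le`.

## References

* N. Levinson, *More than one third of zeros of Riemann's zeta-function are on `σ = 1/2`*,
  Adv. Math. 13 (1974), 383–436, §1.
* N. Levinson, H. L. Montgomery, *Zeros of the derivatives of the Riemann zeta-function*, Acta
  Math. 133 (1974), 49–65, Theorem 1.
* E. C. Titchmarsh, *The Theory of the Riemann Zeta-Function*, 2nd ed. revised by
  D. R. Heath-Brown (Oxford 1986), §10.28, (10.28.2), (10.28.7), (10.28.11); Thm. 9.2.
* J. B. Conrey, *Zeros of derivatives of Riemann's ξ-function on the critical line*, J. Number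
  Theory 16 (1983), 49–74, §2 and §4 (1)–(3).
* K. Pratt, N. Robles, A. Zaharescu, D. Zeindler, *More than five-twelfths of the zeros of `ζ` are
  on the critical line*, Res. Math. Sci. 7 (2020) (arXiv:1802.10521, §1.3 and §8).
  [PrattRoblesZaharescuZeindler2020]
-/

noncomputable section

open Complex Filter Set Asymptotics
open scoped Real Topology ComplexConjugate

namespace Literature.NumberTheory.LFunctions

open Literature.NumberTheory.DiophantineGeometry

/-! ## The reflection `ρ ↦ 1 − ρ̄` on the zeros with `0 < Im ρ ≤ T` -/

/-- `ρ ↦ 1 − ρ̄` is an involution (it is the reflection in the critical line: `Re (1 − ρ̄) = 1 − Re ρ`,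
`Im (1 − ρ̄) = Im ρ`, both by `simp`). [folklore] -/
theorem one_sub_conj_one_sub_conj (ρ : ℂ) : 1 - conj (1 - conj ρ) = ρ := by simp

/-- A zero of `ζ` with `0 < Im ρ` lies in the open strip and its reflection `1 − ρ̄` is again a
zero, of the same multiplicity (`riemannZetaZeroOrder_one_sub_conj`). [cite: Titchmarsh1986, §2.12] -/
theorem riemannZeta_one_sub_conj_eq_zero {ρ : ℂ} (hζ : riemannZeta ρ = 0) (him : 0 < ρ.im) :
    riemannZeta (1 - conj ρ) = 0 := by
  obtain ⟨h0, h1⟩ := re_mem_Ioo_of_riemannZeta_eq_zero_of_im_ne_zero hζ him.ne'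
  have hρ1 : ρ ≠ 1 := by
    rintro rfl
    simp at him
  have hρ1' : 1 - conj ρ ≠ 1 := by
    intro h
    have := congrArg Complex.im h
    simp at this
    exact him.ne' this
  have hpos : 0 < riemannZetaZeroOrder ρ := (riemannZetaZeroOrder_pos_iff hρ1).2 hζ
  rw [← riemannZetaZeroOrder_one_sub_conj h0 h1] at hpos
  exact (riemannZetaZeroOrder_pos_iff hρ1').1 hpos

/-- The reflection `ρ ↦ 1 − ρ̄` maps the box of zeros `0 ≤ Re ρ ≤ 1`, `0 < Im ρ ≤ T` to itself.
[cite: Titchmarsh1986, §2.12] -/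
theorem one_sub_conj_mem_zetaZeroBox {T : ℝ} {ρ : ℂ} (hρ : ρ ∈ zetaZeroBox 0 T) :
    1 - conj ρ ∈ zetaZeroBox 0 T := by
  obtain ⟨hζ, -, -, him, hT⟩ := hρ
  obtain ⟨h0, h1⟩ := re_mem_Ioo_of_riemannZeta_eq_zero_of_im_ne_zero hζ him.ne'
  have hre : (1 - conj ρ).re = 1 - ρ.re := by simp
  have hi : (1 - conj ρ).im = ρ.im := by simp
  refine ⟨riemannZeta_one_sub_conj_eq_zero hζ him, ?_, ?_, ?_, ?_⟩
  · rw [hre]; linarith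
  · rw [hre]; linarith
  · rwa [hi]
  · rwa [hi]

/-- The reflection `ρ ↦ 1 − ρ̄` is a bijection from the zeros with `Re ρ < 1/2`, `0 < Im ρ ≤ T`
onto those with `1/2 < Re ρ`, `0 < Im ρ ≤ T`. [cite: Titchmarsh1986, §2.12] -/
theorem bijOn_one_sub_conj_leftZeros (T : ℝ) :
    BijOn (fun ρ : ℂ ↦ 1 - conj ρ) {ρ ∈ zetaZeroBox 0 T | ρ.re < 1 / 2}
      {ρ ∈ zetaZeroBox 0 T | 1 / 2 < ρ.re} := by
  have hre : ∀ ρ : ℂ, (1 - conj ρ).re = 1 - ρ.re := fun ρ ↦ by simp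
  refine ⟨fun ρ hρ ↦ ⟨one_sub_conj_mem_zetaZeroBox hρ.1, ?_⟩, fun a _ b _ hab ↦ ?_, fun τ hτ ↦ ?_⟩
  · rw [hre]
    linarith [hρ.2]
  · have h := congrArg (fun z : ℂ ↦ 1 - conj z) hab
    simpa only [one_sub_conj_one_sub_conj] using h
  · refine ⟨1 - conj τ, ⟨one_sub_conj_mem_zetaZeroBox hτ.1, ?_⟩, one_sub_conj_one_sub_conj τ⟩
    rw [hre]
    linarith [hτ.2]

/-- The zeros with `1/2 < Re ρ` and those with `Re ρ < 1/2` (`0 < Im ρ ≤ T`) have the same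
multiplicity sum. [cite: Titchmarsh1986, §2.12] -/
theorem finsum_rightZeros_eq_finsum_leftZeros (T : ℝ) :
    ∑ᶠ ρ ∈ {ρ ∈ zetaZeroBox 0 T | 1 / 2 < ρ.re}, riemannZetaZeroOrder ρ =
      ∑ᶠ ρ ∈ {ρ ∈ zetaZeroBox 0 T | ρ.re < 1 / 2}, riemannZetaZeroOrder ρ := by
  refine (finsum_mem_eq_of_bijOn (fun ρ : ℂ ↦ 1 - conj ρ) (bijOn_one_sub_conj_leftZeros T)
    fun ρ hρ ↦ ?_).symm
  obtain ⟨⟨hζ, -, -, him, -⟩, -⟩ := hρ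
  obtain ⟨h0, h1⟩ := re_mem_Ioo_of_riemannZeta_eq_zero_of_im_ne_zero hζ him.ne'
  exact (riemannZetaZeroOrder_one_sub_conj h0 h1).symm

/-! ## `N(T) − N₀(T)` is twice the number of zeros to the left of the critical line -/

/-- **`N(T) − N₀(T) = 2 Σ_{Re ρ < 1/2, 0 < Im ρ ≤ T} m(ρ)`** for every real `T`: the zeros off the
line split into those left and right of it, and the reflection `ρ ↦ 1 − ρ̄` matches the two halves
with multiplicities (the exact identity behind Titchmarsh's (10.28.7)).
[cite: Titchmarsh1986, §10.28 (10.28.7)] -/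
theorem intCast_zetaZeroCount_sub_criticalZeroCount_eq_two_mul_finsum (T : ℝ) :
    (zetaZeroCount T : ℤ) - criticalZeroCount T =
      2 * ∑ᶠ ρ ∈ {ρ ∈ zetaZeroBox 0 T | ρ.re < 1 / 2}, riemannZetaZeroOrder ρ := by
  have hoff := zetaZeroCount_eq_criticalZeroCount_add_finsum T
  have hfin : (zetaZeroBox 0 T).Finite := zetaZeroBox_finite 0 T
  have hunion : {ρ ∈ zetaZeroBox 0 T | ρ.re ≠ 1 / 2} =
      {ρ ∈ zetaZeroBox 0 T | ρ.re < 1 / 2} ∪ {ρ ∈ zetaZeroBox 0 T | 1 / 2 < ρ.re} := by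
    ext ρ
    simp only [mem_union, mem_setOf_eq]
    constructor
    · rintro ⟨h, hne⟩
      rcases lt_or_gt_of_ne hne with hlt | hgt
      · exact Or.inl ⟨h, hlt⟩
      · exact Or.inr ⟨h, hgt⟩
    · rintro (⟨h, hlt⟩ | ⟨h, hgt⟩)
      · exact ⟨h, hlt.ne⟩
      · exact ⟨h, hgt.ne'⟩
  have hdisj : Disjoint {ρ ∈ zetaZeroBox 0 T | ρ.re < 1 / 2} {ρ ∈ zetaZeroBox 0 T | 1 / 2 < ρ.re} := by
    rw [Set.disjoint_left]
    rintro ρ ⟨-, h1⟩ ⟨-, h2⟩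
    linarith
  rw [hunion, finsum_mem_union hdisj (hfin.subset (sep_subset _ _)) (hfin.subset (sep_subset _ _)),
    finsum_rightZeros_eq_finsum_leftZeros] at hoff
  linarith

/-- `N(T) − N₀(T)` is even for every `T` (the zeros off the critical line pair off under
`ρ ↦ 1 − ρ̄`). [cite: Titchmarsh1986, §10.28 (10.28.7)] -/
theorem even_zetaZeroCount_sub_criticalZeroCount (T : ℝ) :
    Even (zetaZeroCount T - criticalZeroCount T) := by
  have h := intCast_zetaZeroCount_sub_criticalZeroCount_eq_two_mul_finsum T
  have hle : criticalZeroCount T ≤ zetaZeroCount T := criticalZeroCount_le T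
  have hcast : ((zetaZeroCount T - criticalZeroCount T : ℕ) : ℤ) =
      2 * ∑ᶠ ρ ∈ {ρ ∈ zetaZeroBox 0 T | ρ.re < 1 / 2}, riemannZetaZeroOrder ρ := by
    rw [Nat.cast_sub hle]
    exact h
  have heven : Even ((zetaZeroCount T - criticalZeroCount T : ℕ) : ℤ) := ⟨_, by rw [hcast, two_mul]⟩
  exact (Int.even_coe_nat _).1 heven

/-! ## Comparison with Levinson–Montgomery's `N⁻(T)` -/

/-- Levinson–Montgomery's box (`0 < Re ρ < 1/2`, `0 < Im ρ < T`) is contained in the left half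
(`Re ρ < 1/2`) of the box `0 < Im ρ ≤ T`. [folklore] -/
theorem zetaLeftBox_subset_leftZeros (T : ℝ) :
    zetaLeftBox T ⊆ {ρ ∈ zetaZeroBox 0 T | ρ.re < 1 / 2} := by
  rintro ρ ⟨hζ, h0, h1, him, hT⟩
  exact ⟨⟨hζ, h0.le, by linarith, him, hT.le⟩, h1⟩

/-- Conversely the left half of the box `0 < Im ρ ≤ T` lies in Levinson–Montgomery's box of any
larger height `T' > T`. [folklore] -/
theorem leftZeros_subset_zetaLeftBox {T T' : ℝ} (hTT' : T < T') :
    {ρ ∈ zetaZeroBox 0 T | ρ.re < 1 / 2} ⊆ zetaLeftBox T' := by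
  rintro ρ ⟨⟨hζ, -, -, him, hT⟩, h1⟩
  exact ⟨hζ, (re_mem_Ioo_of_riemannZeta_eq_zero_of_im_ne_zero hζ him.ne').1, h1, him,
    hT.trans_lt hTT'⟩

/-- If no zero of `ζ` has ordinate exactly `T`, the two boxes coincide. [folklore] -/
theorem leftZeros_eq_zetaLeftBox {T : ℝ} (hT : ∀ ρ : ℂ, riemannZeta ρ = 0 → ρ.im ≠ T) :
    {ρ ∈ zetaZeroBox 0 T | ρ.re < 1 / 2} = zetaLeftBox T := by
  refine Subset.antisymm ?_ (zetaLeftBox_subset_leftZeros T)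
  rintro ρ ⟨⟨hζ, -, -, him, hle⟩, h1⟩
  exact ⟨hζ, (re_mem_Ioo_of_riemannZeta_eq_zero_of_im_ne_zero hζ him.ne').1, h1, him,
    lt_of_le_of_ne hle (hT ρ hζ)⟩

/-- Multiplicities are positive on Levinson–Montgomery's box. [folklore] -/
theorem riemannZetaZeroOrder_pos_of_mem_zetaLeftBox {T : ℝ} {ρ : ℂ} (hρ : ρ ∈ zetaLeftBox T) :
    0 < riemannZetaZeroOrder ρ := by
  refine (riemannZetaZeroOrder_pos_iff ?_).2 hρ.1
  rintro rfl
  norm_num [zetaLeftBox] at hρ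

/-- Monotonicity of the multiplicity sums: if `A ⊆ B`, `B` is finite and the orders are positive
on `B`, then `Σ_A m ≤ Σ_B m` (`finsum_riemannZetaZeroOrder_add_card_le` with no extra zeros).
[folklore] -/
theorem finsum_riemannZetaZeroOrder_mono {A B : Set ℂ} (hB : B.Finite) (hAB : A ⊆ B)
    (hpos : ∀ ρ ∈ B, 0 < riemannZetaZeroOrder ρ) :
    ∑ᶠ ρ ∈ A, riemannZetaZeroOrder ρ ≤ ∑ᶠ ρ ∈ B, riemannZetaZeroOrder ρ := by
  have h := finsum_riemannZetaZeroOrder_add_card_le hB hAB hpos ∅ (by simp)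
  simpa using h

/-- **`2N⁻(T) ≤ N(T) − N₀(T)`** for every `T` (Levinson–Montgomery's box `Im ρ < T` is part of
the left half of the box `Im ρ ≤ T`). [cite: Titchmarsh1986, §10.28 (10.28.7)] -/
theorem two_mul_zetaLeftCount_le (T : ℝ) :
    2 * zetaLeftCount T ≤ zetaZeroCount T - criticalZeroCount T := by
  have h := intCast_zetaZeroCount_sub_criticalZeroCount_eq_two_mul_finsum T
  have hmono := finsum_riemannZetaZeroOrder_mono
    ((zetaZeroBox_finite 0 T).subset (sep_subset _ _)) (zetaLeftBox_subset_leftZeros T)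
    (fun ρ hρ ↦ riemannZetaZeroOrder_pos_of_mem_zetaZeroBox hρ.1)
  have hint := zetaLeftCount_int T
  have hle : criticalZeroCount T ≤ zetaZeroCount T := criticalZeroCount_le T
  zify [hle]
  linarith

/-- **`N(T) − N₀(T) ≤ 2N⁻(T')`** for `T < T'`. [cite: Titchmarsh1986, §10.28 (10.28.7)] -/
theorem zetaZeroCount_sub_criticalZeroCount_le_two_mul_zetaLeftCount {T T' : ℝ} (hTT' : T < T') :
    zetaZeroCount T - criticalZeroCount T ≤ 2 * zetaLeftCount T' := by
  have h := intCast_zetaZeroCount_sub_criticalZeroCount_eq_two_mul_finsum T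
  have hmono := finsum_riemannZetaZeroOrder_mono (zetaLeftBox_finite T')
    (leftZeros_subset_zetaLeftBox hTT') (fun ρ hρ ↦ riemannZetaZeroOrder_pos_of_mem_zetaLeftBox hρ)
  have hint := zetaLeftCount_int T'
  have hle : criticalZeroCount T ≤ zetaZeroCount T := criticalZeroCount_le T
  zify [hle]
  linarith

/-- **`N(T) − N₀(T) = 2N⁻(T)`** when `T` is not the ordinate of a zero (then `Im ρ ≤ T` and
`Im ρ < T` define the same box). [cite: Titchmarsh1986, §10.28 (10.28.7)] -/
theorem zetaZeroCount_sub_criticalZeroCount_eq_two_mul_zetaLeftCount {T : ℝ}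
    (hT : ∀ ρ : ℂ, riemannZeta ρ = 0 → ρ.im ≠ T) :
    zetaZeroCount T - criticalZeroCount T = 2 * zetaLeftCount T := by
  have h := intCast_zetaZeroCount_sub_criticalZeroCount_eq_two_mul_finsum T
  rw [leftZeros_eq_zetaLeftBox hT, ← zetaLeftCount_int] at h
  have hle : criticalZeroCount T ≤ zetaZeroCount T := criticalZeroCount_le T
  zify [hle]
  linarith

/-! ## `N(T) − N(T − 1) = O(log T)` and Titchmarsh's (10.28.7) -/

/-- Increment of the Riemann–von Mangoldt main term over `[T − 1, T]`: for `T ≥ 2`,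
`M(T) − M(T − 1) ≤ (1/2π) log(T/2π)` where `M(u) = (u/2π) log(u/2π) − u/2π` (from
`log x ≤ x − 1`). [cite: Titchmarsh1986, Thm. 9.4] -/
theorem rvm_mainTerm_sub_le {T : ℝ} (hT : 2 ≤ T) :
    (T / (2 * π) * Real.log (T / (2 * π)) - T / (2 * π)) -
        ((T - 1) / (2 * π) * Real.log ((T - 1) / (2 * π)) - (T - 1) / (2 * π)) ≤
      1 / (2 * π) * Real.log (T / (2 * π)) := by
  have hπ : 0 < 2 * π := by positivity
  have ha : 0 < T - 1 := by linarith
  have hlog : Real.log (T / (2 * π)) - Real.log ((T - 1) / (2 * π)) = Real.log (T / (T - 1)) := by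
    rw [← Real.log_div (by positivity) (by positivity)]
    congr 1
    field_simp
  have hkey : (T - 1) * (Real.log (T / (2 * π)) - Real.log ((T - 1) / (2 * π))) ≤ 1 := by
    rw [hlog]
    have h := Real.log_le_sub_one_of_pos (show 0 < T / (T - 1) by positivity)
    calc (T - 1) * Real.log (T / (T - 1)) ≤ (T - 1) * (T / (T - 1) - 1) :=
          mul_le_mul_of_nonneg_left h ha.le
      _ = 1 := by field_simp; ring
  rw [show (T / (2 * π) * Real.log (T / (2 * π)) - T / (2 * π)) -
        ((T - 1) / (2 * π) * Real.log ((T - 1) / (2 * π)) - (T - 1) / (2 * π)) =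
      (Real.log (T / (2 * π)) +
        (T - 1) * (Real.log (T / (2 * π)) - Real.log ((T - 1) / (2 * π))) - 1) / (2 * π) by ring,
    show 1 / (2 * π) * Real.log (T / (2 * π)) = Real.log (T / (2 * π)) / (2 * π) by ring]
  exact div_le_div_of_nonneg_right (by linarith) hπ.le

/-- **`N(T) − N(T − 1) = O(log T)`** (Titchmarsh Thm. 9.2, here deduced from the Riemann–von
Mangoldt formula, Thm. 9.4, proved in the tree as `riemann_von_mangoldt_holds`: the error terms at
`T` and `T − 1` are `O(log T)` and the main term increases by `≤ (1/2π) log(T/2π)`).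
[cite: Titchmarsh1986, Thm. 9.2] -/
theorem isBigO_zetaZeroCount_sub_zetaZeroCount_sub_one :
    (fun T : ℝ ↦ (zetaZeroCount T : ℝ) - zetaZeroCount (T - 1)) =O[atTop] Real.log := by
  obtain ⟨C₀, hC₀, hbd⟩ := riemann_von_mangoldt_holds.exists_pos
  have h1 : ∀ᶠ T : ℝ in atTop,
      |(zetaZeroCount T : ℝ) - (T / (2 * π) * Real.log (T / (2 * π)) - T / (2 * π))| ≤
        C₀ * Real.log T := by
    filter_upwards [hbd.bound, eventually_ge_atTop (1 : ℝ)] with T hT h1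
    rwa [Real.norm_eq_abs, Real.norm_of_nonneg (Real.log_nonneg h1)] at hT
  have hshift : Tendsto (fun T : ℝ ↦ T - 1) atTop atTop :=
    (tendsto_atTop_add_const_right atTop (-1 : ℝ) tendsto_id).congr fun T ↦ by
      simp only [id]; ring
  have h2 := hshift.eventually h1
  refine IsBigO.of_bound (2 * C₀ + 1) ?_
  filter_upwards [h1, h2, eventually_ge_atTop (8 : ℝ)] with T hT hT' h8
  have hπ3 := Real.pi_gt_three
  have hπ4 := Real.pi_lt_four
  have hlogT : 0 ≤ Real.log T := Real.log_nonneg (by linarith)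
  have hlog1 : Real.log (T - 1) ≤ Real.log T := Real.log_le_log (by linarith) (by linarith)
  have hlog2 : Real.log (T / (2 * π)) ≤ Real.log T :=
    Real.log_le_log (by positivity) (div_le_self (by linarith) (by linarith))
  have hlog3 : 0 ≤ Real.log (T / (2 * π)) := Real.log_nonneg (by rw [le_div_iff₀ (by positivity)]; linarith)
  have hmain := rvm_mainTerm_sub_le (show (2 : ℝ) ≤ T by linarith)
  have hmono : (zetaZeroCount (T - 1) : ℝ) ≤ zetaZeroCount T := by
    exact_mod_cast zetaZeroCount_mono (show T - 1 ≤ T by linarith)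
  have hA := (abs_le.1 hT).2
  have hB := (abs_le.1 hT').1
  have hcoef : 1 / (2 * π) * Real.log (T / (2 * π)) ≤ Real.log T := by
    have : 1 / (2 * π) ≤ 1 := by rw [div_le_one (by positivity)]; linarith
    nlinarith
  rw [Real.norm_of_nonneg (by linarith), Real.norm_of_nonneg hlogT]
  nlinarith

/-- The left half of the box `0 < Im ρ ≤ T` is covered by Levinson–Montgomery's box of height `T`
together with the zeros of ordinate exactly `T`. [folklore] -/
theorem leftZeros_subset_zetaLeftBox_union (T : ℝ) :
    {ρ ∈ zetaZeroBox 0 T | ρ.re < 1 / 2} ⊆ zetaLeftBox T ∪ {ρ ∈ zetaZeroBox 0 T | ρ.im = T} := by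
  rintro ρ ⟨⟨hζ, h0, h1', him, hle⟩, h1⟩
  rcases lt_or_eq_of_le hle with hlt | heq
  · exact Or.inl ⟨hζ, (re_mem_Ioo_of_riemannZeta_eq_zero_of_im_ne_zero hζ him.ne').1, h1, him, hlt⟩
  · exact Or.inr ⟨⟨hζ, h0, h1', him, hle⟩, heq⟩

/-- The zeros of ordinate exactly `T` have total multiplicity at most `N(T) − N(T − 1)`.
[folklore] -/
theorem finsum_ordinate_eq_le (T : ℝ) :
    ∑ᶠ ρ ∈ {ρ ∈ zetaZeroBox 0 T | ρ.im = T}, riemannZetaZeroOrder ρ ≤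
      (zetaZeroCount T : ℤ) - zetaZeroCount (T - 1) := by
  have hfin : (zetaZeroBox 0 T).Finite := zetaZeroBox_finite 0 T
  have hsub : zetaZeroBox 0 (T - 1) ⊆ zetaZeroBox 0 T := by
    rintro ρ ⟨hζ, h0, h1, him, hle⟩
    exact ⟨hζ, h0, h1, him, by linarith⟩
  have hE : {ρ ∈ zetaZeroBox 0 T | ρ.im = T} ⊆ zetaZeroBox 0 T \ zetaZeroBox 0 (T - 1) := by
    rintro ρ ⟨hρ, heq⟩
    refine ⟨hρ, ?_⟩
    rintro ⟨-, -, -, -, hle⟩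
    linarith
  have hmono := finsum_riemannZetaZeroOrder_mono (hfin.subset Set.sdiff_subset) hE
    (fun ρ hρ ↦ riemannZetaZeroOrder_pos_of_mem_zetaZeroBox hρ.1)
  have hsplit : ∑ᶠ ρ ∈ zetaZeroBox 0 T, riemannZetaZeroOrder ρ =
      ∑ᶠ ρ ∈ zetaZeroBox 0 (T - 1), riemannZetaZeroOrder ρ +
        ∑ᶠ ρ ∈ zetaZeroBox 0 T \ zetaZeroBox 0 (T - 1), riemannZetaZeroOrder ρ := by
    conv_lhs => rw [← Set.union_sdiff_cancel hsub]
    exact finsum_mem_union disjoint_sdiff_right (hfin.subset hsub) (hfin.subset Set.sdiff_subset)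
  rw [zetaZeroCount_eq_finsum, zetaZeroCount_eq_finsum]
  linarith

/-- `0 ≤ (N(T) − N₀(T)) − 2N⁻(T) ≤ 2 (N(T) − N(T − 1))`: the two left counts differ only by the
zeros of ordinate exactly `T`. [folklore] -/
theorem abs_sub_two_mul_zetaLeftCount_le (T : ℝ) :
    |((zetaZeroCount T : ℝ) - criticalZeroCount T) - 2 * zetaLeftCount T| ≤
      2 * ((zetaZeroCount T : ℝ) - zetaZeroCount (T - 1)) := by
  have h := intCast_zetaZeroCount_sub_criticalZeroCount_eq_two_mul_finsum T
  have hfin : (zetaZeroBox 0 T).Finite := zetaZeroBox_finite 0 T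
  have hL : (zetaLeftBox T).Finite := zetaLeftBox_finite T
  have hEfin : {ρ ∈ zetaZeroBox 0 T | ρ.im = T}.Finite := hfin.subset (sep_subset _ _)
  have hdisj : Disjoint (zetaLeftBox T) {ρ ∈ zetaZeroBox 0 T | ρ.im = T} := by
    rw [Set.disjoint_left]
    rintro ρ ⟨-, -, -, -, hlt⟩ ⟨-, heq⟩
    linarith
  -- upper bound: `Σ_left ≤ N⁻(T) + Σ_{Im ρ = T}`
  have hup : ∑ᶠ ρ ∈ {ρ ∈ zetaZeroBox 0 T | ρ.re < 1 / 2}, riemannZetaZeroOrder ρ ≤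
      ∑ᶠ ρ ∈ zetaLeftBox T, riemannZetaZeroOrder ρ +
        ∑ᶠ ρ ∈ {ρ ∈ zetaZeroBox 0 T | ρ.im = T}, riemannZetaZeroOrder ρ := by
    rw [← finsum_mem_union hdisj hL hEfin]
    refine finsum_riemannZetaZeroOrder_mono (hL.union hEfin) (leftZeros_subset_zetaLeftBox_union T)
      ?_
    rintro ρ (hρ | hρ)
    · exact riemannZetaZeroOrder_pos_of_mem_zetaLeftBox hρ
    · exact riemannZetaZeroOrder_pos_of_mem_zetaZeroBox hρ.1
  -- lower bound: `N⁻(T) ≤ Σ_left`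
  have hlow := finsum_riemannZetaZeroOrder_mono (hfin.subset (sep_subset _ _))
    (zetaLeftBox_subset_leftZeros T) (fun ρ hρ ↦ riemannZetaZeroOrder_pos_of_mem_zetaZeroBox hρ.1)
  have hE := finsum_ordinate_eq_le T
  have hint := zetaLeftCount_int T
  -- pass to `ℝ`
  have h' : ((zetaZeroCount T : ℝ) - criticalZeroCount T) - 2 * zetaLeftCount T =
      (2 * (∑ᶠ ρ ∈ {ρ ∈ zetaZeroBox 0 T | ρ.re < 1 / 2}, riemannZetaZeroOrder ρ -
        ∑ᶠ ρ ∈ zetaLeftBox T, riemannZetaZeroOrder ρ) : ℤ) := by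
    push_cast
    have h1 : ((zetaZeroCount T : ℤ) : ℝ) - ((criticalZeroCount T : ℤ) : ℝ) =
        ((2 * ∑ᶠ ρ ∈ {ρ ∈ zetaZeroBox 0 T | ρ.re < 1 / 2}, riemannZetaZeroOrder ρ : ℤ) : ℝ) := by
      exact_mod_cast congrArg (fun z : ℤ ↦ (z : ℝ)) h
    have h2 : ((zetaLeftCount T : ℤ) : ℝ) = ((∑ᶠ ρ ∈ zetaLeftBox T, riemannZetaZeroOrder ρ : ℤ) : ℝ) := by
      exact_mod_cast congrArg (fun z : ℤ ↦ (z : ℝ)) hint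
    push_cast at h1 h2
    linarith
  have hdiff : ((zetaZeroCount T : ℝ) - zetaZeroCount (T - 1)) =
      (((zetaZeroCount T : ℤ) - zetaZeroCount (T - 1) : ℤ) : ℝ) := by push_cast; ring
  rw [h', hdiff, abs_le]
  constructor
  · have : (0 : ℤ) ≤ 2 * (∑ᶠ ρ ∈ {ρ ∈ zetaZeroBox 0 T | ρ.re < 1 / 2}, riemannZetaZeroOrder ρ -
        ∑ᶠ ρ ∈ zetaLeftBox T, riemannZetaZeroOrder ρ) := by linarith
    have h0 : (0 : ℝ) ≤ ((2 * (∑ᶠ ρ ∈ {ρ ∈ zetaZeroBox 0 T | ρ.re < 1 / 2}, riemannZetaZeroOrder ρ -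
        ∑ᶠ ρ ∈ zetaLeftBox T, riemannZetaZeroOrder ρ) : ℤ) : ℝ) := by exact_mod_cast this
    have h0' : (0 : ℝ) ≤ (((zetaZeroCount T : ℤ) - zetaZeroCount (T - 1) : ℤ) : ℝ) := by
      have : (0 : ℤ) ≤ (zetaZeroCount T : ℤ) - zetaZeroCount (T - 1) := by
        have := zetaZeroCount_mono (show T - 1 ≤ T by linarith)
        omega
      exact_mod_cast this
    linarith
  · have : 2 * (∑ᶠ ρ ∈ {ρ ∈ zetaZeroBox 0 T | ρ.re < 1 / 2}, riemannZetaZeroOrder ρ -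
        ∑ᶠ ρ ∈ zetaLeftBox T, riemannZetaZeroOrder ρ) ≤
        2 * ((zetaZeroCount T : ℤ) - zetaZeroCount (T - 1)) := by linarith
    exact_mod_cast this

/-- `N₀(T) − (N(T) − 2N⁻(T)) = O(log T)` with Levinson–Montgomery's `N⁻(T)` (zeros of `ζ` in
`0 < σ < 1/2`, `0 < t < T`): the exact identity up to the zeros of ordinate `T`, which number
`O(log T)`. [cite: Titchmarsh1986, §10.28 (10.28.7)] -/
theorem isBigO_criticalZeroCount_levinson_zetaLeftCount :
    (fun T : ℝ ↦ (criticalZeroCount T : ℝ) - ((zetaZeroCount T : ℝ) - 2 * zetaLeftCount T))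
      =O[atTop] Real.log := by
  refine IsBigO.trans (g := fun T : ℝ ↦ (zetaZeroCount T : ℝ) - zetaZeroCount (T - 1)) ?_
    isBigO_zetaZeroCount_sub_zetaZeroCount_sub_one
  refine IsBigO.of_bound 2 (Eventually.of_forall fun T ↦ ?_)
  have h := abs_sub_two_mul_zetaLeftCount_le T
  have hnn : (0 : ℝ) ≤ (zetaZeroCount T : ℝ) - zetaZeroCount (T - 1) := by
    have := zetaZeroCount_mono (show T - 1 ≤ T by linarith)
    have : (zetaZeroCount (T - 1) : ℝ) ≤ zetaZeroCount T := by exact_mod_cast this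
    linarith
  rw [Real.norm_eq_abs, Real.norm_of_nonneg hnn, abs_sub_comm]
  have e : (zetaZeroCount T : ℝ) - 2 * zetaLeftCount T - criticalZeroCount T =
      ((zetaZeroCount T : ℝ) - criticalZeroCount T) - 2 * zetaLeftCount T := by ring
  rw [show ((zetaZeroCount T : ℝ) - 2 * ↑(zetaLeftCount T) - ↑(criticalZeroCount T)) =
    ((zetaZeroCount T : ℝ) - criticalZeroCount T) - 2 * zetaLeftCount T by ring]
  exact h

/-- **Titchmarsh's (10.28.7)**, `T`-version: `N₀(T) = N(T) − 2N₁⁻(T) + O(log T)`, where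
`N₁⁻(T) = derivZetaLeftCount T` is the number of zeros of `ζ'` in `0 < σ < 1/2`, `0 < t < T`
(with multiplicity). From the reflection identity and Levinson–Montgomery's Theorem 1
(`levinsonMontgomery_thm1_isBigO_holds`: `N₁⁻(T) = N⁻(T) + O(log T)`).
[cite: Titchmarsh1986, §10.28 (10.28.2), (10.28.7)] -/
theorem isBigO_criticalZeroCount_levinson :
    (fun T : ℝ ↦ (criticalZeroCount T : ℝ) - ((zetaZeroCount T : ℝ) - 2 * derivZetaLeftCount T))
      =O[atTop] Real.log := by
  have h1 := isBigO_criticalZeroCount_levinson_zetaLeftCount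
  have h2 : (fun T : ℝ ↦ 2 * ((derivZetaLeftCount T : ℝ) - zetaLeftCount T)) =O[atTop] Real.log :=
    (levinsonMontgomery_thm1_isBigO_holds).const_mul_left 2
  refine (h1.add h2).congr_left fun T ↦ ?_
  ring

/-! ## The critical-line proportion via the zeros of `ζ'` left of the line -/

/-- `log T = o(N(T))` (indeed `N(T) ≥ T` for large `T`, Riemann–von Mangoldt). [cite: Titchmarsh1986, Thm. 9.4] -/
theorem isLittleO_log_zetaZeroCount :
    Real.log =o[atTop] fun T : ℝ ↦ (zetaZeroCount T : ℝ) := by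
  refine Real.isLittleO_log_id_atTop.trans_isBigO (IsBigO.of_bound 1 ?_)
  filter_upwards [riemann_von_mangoldt_holds.eventually_self_le, eventually_ge_atTop (0 : ℝ)]
    with T hT h0
  rw [one_mul, id, Real.norm_of_nonneg h0, Real.norm_of_nonneg (Nat.cast_nonneg _)]
  exact hT

/-- **Template.** If `f : ℝ → ℝ` satisfies `N₀(T) = N(T) − 2 f(T) + o(N(T))`, then for every real
`α`: `α ≤ κ ↔ ∀ ε > 0, 2 f(T) ≤ (1 − α + ε) N(T)` for all large `T`
(`le_criticalLineProportion_iff`: `α ≤ κ ↔ ∀ ε > 0, (α − ε) N(T) ≤ N₀(T)` eventually). [folklore] -/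
theorem le_criticalLineProportion_iff_of_isLittleO {f : ℝ → ℝ}
    (hf : (fun T : ℝ ↦ (criticalZeroCount T : ℝ) - ((zetaZeroCount T : ℝ) - 2 * f T)) =o[atTop]
      fun T : ℝ ↦ (zetaZeroCount T : ℝ)) {α : ℝ} :
    α ≤ criticalLineProportion ↔
      ∀ ε : ℝ, 0 < ε → ∀ᶠ T : ℝ in atTop, 2 * f T ≤ (1 - α + ε) * zetaZeroCount T := by
  rw [le_criticalLineProportion_iff]
  have hb : ∀ ε : ℝ, 0 < ε → ∀ᶠ T : ℝ in atTop,
      |(criticalZeroCount T : ℝ) - ((zetaZeroCount T : ℝ) - 2 * f T)| ≤ ε * zetaZeroCount T := by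
    intro ε hε
    filter_upwards [hf.def hε] with T hT
    rwa [Real.norm_eq_abs, Real.norm_of_nonneg (Nat.cast_nonneg _)] at hT
  constructor
  · intro h ε hε
    filter_upwards [h (ε / 2) (by positivity), hb (ε / 2) (by positivity)] with T h1 h2
    have := (abs_le.1 h2).2
    linarith
  · intro h ε hε
    filter_upwards [h (ε / 2) (by positivity), hb (ε / 2) (by positivity)] with T h1 h2
    have := (abs_le.1 h2).1
    linarith

/-- **`κ` via the zeros of `ζ` left of the line**: `α ≤ κ ↔ ∀ ε > 0, 2N⁻(T) ≤ (1 − α + ε) N(T)`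
for all large `T`. [cite: Titchmarsh1986, §10.28 (10.28.7)] -/
theorem le_criticalLineProportion_iff_zetaLeftCount {α : ℝ} :
    α ≤ criticalLineProportion ↔
      ∀ ε : ℝ, 0 < ε →
        ∀ᶠ T : ℝ in atTop, 2 * (zetaLeftCount T : ℝ) ≤ (1 - α + ε) * zetaZeroCount T :=
  le_criticalLineProportion_iff_of_isLittleO
    (isBigO_criticalZeroCount_levinson_zetaLeftCount.trans_isLittleO isLittleO_log_zetaZeroCount)

/-- **`κ` via the zeros of `ζ'` left of the line** (Levinson's reduction): for every real `α`,
`α ≤ κ ↔ ∀ ε > 0, 2N₁⁻(T) ≤ (1 − α + ε) N(T)` for all large `T`.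
[cite: Titchmarsh1986, §10.28 (10.28.7)] -/
theorem le_criticalLineProportion_iff_derivZetaLeftCount {α : ℝ} :
    α ≤ criticalLineProportion ↔
      ∀ ε : ℝ, 0 < ε →
        ∀ᶠ T : ℝ in atTop, 2 * (derivZetaLeftCount T : ℝ) ≤ (1 - α + ε) * zetaZeroCount T :=
  le_criticalLineProportion_iff_of_isLittleO
    (isBigO_criticalZeroCount_levinson.trans_isLittleO isLittleO_log_zetaZeroCount)

/-- Strict form: `α < κ ↔ ∃ c < 1 − α, 2N₁⁻(T) ≤ c N(T)` for all large `T`.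
[cite: Titchmarsh1986, §10.28 (10.28.7)] -/
theorem lt_criticalLineProportion_iff_derivZetaLeftCount {α : ℝ} :
    α < criticalLineProportion ↔
      ∃ c : ℝ, c < 1 - α ∧
        ∀ᶠ T : ℝ in atTop, 2 * (derivZetaLeftCount T : ℝ) ≤ c * zetaZeroCount T := by
  constructor
  · intro h
    set κ := criticalLineProportion with hκ
    have hle : (α + κ) / 2 ≤ κ := by linarith
    have hε : 0 < (κ - α) / 4 := by linarith
    refine ⟨1 - (α + κ) / 2 + (κ - α) / 4, by linarith, ?_⟩
    exact (le_criticalLineProportion_iff_derivZetaLeftCount.1 hle) _ hε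
  · rintro ⟨c, hc, h⟩
    have hα : α < 1 - c - (1 - α - c) / 2 := by linarith
    refine lt_of_lt_of_le hα (le_criticalLineProportion_iff_derivZetaLeftCount.2 fun ε hε ↦ ?_)
    filter_upwards [h] with T hT
    have hN : (0 : ℝ) ≤ zetaZeroCount T := Nat.cast_nonneg _
    have hc' : c ≤ 1 - (1 - c - (1 - α - c) / 2) + ε := by linarith
    nlinarith

/-- **`przz_bound` via the zeros of `ζ'`.** The named fact `przz_bound` (`κ > 5/12`,
Pratt–Robles–Zaharescu–Zeindler 2020) is equivalent to: for some `c < 7/12`,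
`2N₁⁻(T) ≤ c N(T)` for all large `T` — i.e. (asymptotically) fewer than `7/24 · N(T)` zeros of
`ζ'`, with multiplicity, in `0 < Re s < 1/2`, `0 < Im s < T`.
[cite: PrattRoblesZaharescuZeindler2020, Thm. 1.1; Titchmarsh1986 §10.28 (10.28.7)] -/
theorem przz_bound_iff_derivZetaLeftCount :
    przz_bound ↔
      ∃ c : ℝ, c < 7 / 12 ∧
        ∀ᶠ T : ℝ in atTop, 2 * (derivZetaLeftCount T : ℝ) ≤ c * zetaZeroCount T := by
  rw [show (7 : ℝ) / 12 = 1 - 5 / 12 by norm_num]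
  exact lt_criticalLineProportion_iff_derivZetaLeftCount

/-- The reduction in the direction it is used: an eventual bound `2N₁⁻(T) ≤ c N(T)` with
`c < 7/12` proves `przz_bound`. [cite: PrattRoblesZaharescuZeindler2020, Thm. 1.1] -/
theorem przz_bound_of_derivZetaLeftCount_le {c : ℝ} (hc : c < 7 / 12)
    (h : ∀ᶠ T : ℝ in atTop, 2 * (derivZetaLeftCount T : ℝ) ≤ c * zetaZeroCount T) : przz_bound :=
  przz_bound_iff_derivZetaLeftCount.2 ⟨c, hc, h⟩

end Literature.NumberTheory.LFunctions

end
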